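import Summits.Ventures.Crystal3D.Theorems.StickyWulffConstantPolycrystalWulffBoundRungSuperTree

/-!
# `PolycrystalWulffBound`, line `PolyDensity`: a parent grain with SLID TWIN COLONIES about several axes
# (`rung_slidColonies`; crux `stmt-Ventures-19482`)

Route `StickyWulffConstant` of the venture `Summits/Ventures/Crystal3D`, second prover lane (poly-p2,
gen 13).  The zero-budget rungs `rung_twinCaps` / `rung_twinColonies` (gen 12) treat a parent carrying
caps / basal-lamellar colonies about different `⟨111⟩` axes, every wall a coherent basal plane.  Here the
colonies are ARBITRARY SINGLE-AXIS TWIN NETWORKS: colony `i` (the cells `j` with `col j = i.succ`) lies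
above the cap plane `⟪x, ax i⟫ = t i` of the parent, its cells are co-axial with the parent frame `A₀`
about `ax i` (Bool labels = the two lattices), its internal twin walls may have ANY normals (inclined
lamella ends, steps, the wall against the parent's cap layer — put the parent's cap cells INTO the
colony, label of `A₀`), and it carries its own horizontal bond `uS i.succ ∈ A₀ Λ₀` and `⟨112⟩` direction
`wS i.succ`.  The core (cells with `col j = 0`, body `W(A₀)`) lies below every cap plane wherever
`δ`-close to that colony; distinct colonies are `δ`-apart.  CONCLUSION:
`6·2^{1/3}(√2·Vol)^{2/3} ≤ Fr + (1/√6)·Σ_{col j = col j' ≠ 0, τ j ≠ τ j'} |⟪wS (col j), ν_{jj'}⟫|·facetArea` —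
the cap planes are free, each colony pays its own twin walls at its own slide rate.  Instance of
`rung_superTree_cells` (star-shaped tree, one reference frame `A₀`, profile condition `rfl`).
WHAT THIS IS NOT: colonies touching each other; cycles; the crux is not claimed.
-/

noncomputable section

open scoped BigOperators InnerProductSpace ENNReal Pointwise
open MeasureTheory Filter Set

namespace Summit.Ventures.Crystal3D.Cruxes.PolycrystalWulffBound.PolyDensity

open Summit.Ventures.Crystal3D.Theorems
open Summit.Ventures.Crystal3D.Cruxes.TextureLiminf.TexShadow (per polytope E3 facetArea)
open Literature.MathematicalPhysics.StatisticalMechanics (fccStacking barlowStacking IsHaggSeq perimeter)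

/-- **Rung `rung_slidColonies`**: a parent (core cells `col j = 0`, body `W(A₀)`) with `q` single-axis
twin colonies (cells `col j = i.succ`, co-axial with `A₀` about `ax i`, above the cap plane
`⟪x, ax i⟫ = t i`, pairwise `δ`-apart, one (bond, `⟨112⟩`) pair per colony) satisfies
`6·2^{1/3}(√2·Vol)^{2/3} ≤ Fr + (1/√6)·Σ_{col j = col j' ≠ 0, τ j ≠ τ j'} |⟪wS (col j), ν_{jj'}⟫|·facetArea`. -/
theorem rung_slidColonies : let Λ : Set (EuclideanSpace ℝ (Fin 3)) := Literature.MathematicalPhysics.StatisticalMechanics.fccStacking 1 (Real.sqrt (2 / 3)); let Brl : (ℤ → ℤ) → Set (EuclideanSpace ℝ (Fin 3)) := Literature.MathematicalPhysics.StatisticalMechanics.barlowStacking 1 (Real.sqrt (2 / 3)); let Ax : EuclideanSpace ℝ (Fin 3) → (EuclideanSpace ℝ (Fin 3) ≃ₗᵢ[ℝ] EuclideanSpace ℝ (Fin 3)) → (EuclideanSpace ℝ (Fin 3) ≃ₗᵢ[ℝ] EuclideanSpace ℝ (Fin 3)) → Prop := fun m A B => ∃ (L : EuclideanSpace ℝ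 (Fin 3) ≃ₗᵢ[ℝ] EuclideanSpace ℝ (Fin 3)) (s₁ s₂ : EuclideanSpace ℝ (Fin 3)) (σ σ' : ℤ → ℤ), Literature.MathematicalPhysics.StatisticalMechanics.IsHaggSeq σ ∧ Literature.MathematicalPhysics.StatisticalMechanics.IsHaggSeq σ' ∧ L (EuclideanSpace.single (2 : Fin 3) (1 : ℝ)) = m ∧ A '' Λ ⊆ (fun q => L q + s₁) '' Brl σ ∧ B '' Λ ⊆ (fun q => L q + s₂) '' Brl σ'; let Φ : EuclideanSpace ℝ (Fin 3) → ℝ := fun ν => Real.sqrt 2 / 4 * ∑ᶠ w ∈ {w ∈ Λ | ‖w‖ = 1}, |⟪w, ν⟫_ℝ|; let Per : Set (EuclideanSpace ℝ (Fin 3)) → Set (EuclideanSpace ℝ (Fin 3)) → ℝ := fun K S => (⨆ (ξ : EuclideanSpace ℝ (Fin 3) → EuclideanSpace ℝ (Fin 3)) (_ : ContDiff ℝ 1 ξ ∧ HasCompactSupport ξ ∧ ∀ z, ξ z ∈ K), ENNReal.ofReal (∫ z in S, Literature.MathematicalPhysics.StatisticalMechanics.fieldDivergence ξ z)).toReal;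 let ι : Set (EuclideanSpace ℝ (Fin 3)) → Set (EuclideanSpace ℝ (Fin 3)) → Set (EuclideanSpace ℝ (Fin 3)) → ℝ := fun K S₁ S₂ => (Per K S₁ + Per K S₂ - Per K (S₁ ∪ S₂)) / 2; let W : (EuclideanSpace ℝ (Fin 3) ≃ₗᵢ[ℝ] EuclideanSpace ℝ (Fin 3)) → Set (EuclideanSpace ℝ (Fin 3)) := fun A => {y | ∀ ν : EuclideanSpace ℝ (Fin 3), ⟪y, ν⟫_ℝ ≤ Φ (A.symm ν)}; let Vol : (n : ℕ) → (Fin n → Set (EuclideanSpace ℝ (Fin 3))) → ℝ := fun n G => (volume (⋃ f : Fin n, G f)).toReal; let Fr : (n : ℕ) → (Fin n → Set (EuclideanSpace ℝ (Fin 3))) → (Fin n → (EuclideanSpace ℝ (Fin 3) ≃ₗᵢ[ℝ] EuclideanSpace ℝ (Fin 3))) → ℝ := fun n G A => ∑ f : Fin n, Per (W (A f)) (G f) - ∑ f, ∑ g, (if f = g then 0 else ι (W (A f)) (G f) (G g)); ∀ (k : ℕ) (H : Fin k → Finset ((EuclideanSpace ℝ (Fin 3)) × ℝ)), let Q : Fin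 k → Set (EuclideanSpace ℝ (Fin 3)) := fun j => ⋂ p ∈ H j, {x : EuclideanSpace ℝ (Fin 3) | ⟪p.1, x⟫_ℝ < p.2}; ∀ (A : Fin k → (EuclideanSpace ℝ (Fin 3) ≃ₗᵢ[ℝ] EuclideanSpace ℝ (Fin 3))) (nv : Fin k → Fin k → EuclideanSpace ℝ (Fin 3)) (τ : Fin k → Bool) (q : ℕ) (col : Fin k → Fin (q + 1)) (A₀ : EuclideanSpace ℝ (Fin 3) ≃ₗᵢ[ℝ] EuclideanSpace ℝ (Fin 3)) (ax : Fin q → EuclideanSpace ℝ (Fin 3)) (t : Fin q → ℝ) (uS wS : Fin (q + 1) → EuclideanSpace ℝ (Fin 3)) (δ : ℝ), (∀ j, Bornology.IsBounded (Q j)) → (∀ j j', j ≠ j' → Disjoint (Q j) (Q j')) → (∀ i j, nv j i = -nv i j) → (∀ j j', j ≠ j' → ‖nv j j'‖ = 1 ∧ ∃ b : ℝ, closure (Q j) ∩ closure (Q j') ⊆ {x | ⟪nv j j', x⟫_ℝ = b}) → (∀ i, ‖ax i‖ = 1) → 0 < δ → (∀ (i : Fin q) j, col j = i.succ → ∀ x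 ∈ Q j, t i < ⟪x, ax i⟫_ℝ) → (∀ (i : Fin q) j, col j = 0 → ∀ x ∈ Q j, ⟪x, ax i⟫_ℝ < t i ∨ ∀ j', col j' = i.succ → ∀ y ∈ Q j', δ ≤ dist x y) → (∀ j j', col j ≠ col j' → col j ≠ 0 → col j' ≠ 0 → ∀ x ∈ Q j, ∀ y ∈ Q j', δ ≤ dist x y) → (∀ j, col j = 0 → W (A j) = W A₀) → (∀ (i : Fin q) j, col j = i.succ → Ax (ax i) A₀ (A j)) → (∀ i : Fin q, ‖uS i.succ‖ = 1 ∧ ‖wS i.succ‖ = 1 ∧ ⟪uS i.succ, ax i⟫_ℝ = 0 ∧ ⟪wS i.succ, ax i⟫_ℝ = 0 ∧ ⟪wS i.succ, uS i.succ⟫_ℝ = 0) → (∀ i : Fin q, uS i.succ ∈ A₀ '' Λ ∧ (ℝ ∙ uS i.succ)ᗮ.reflection '' (A₀ '' Λ) = A₀ '' Λ) → (∀ j j', col j = col j' → τ j = τ j' → W (A j) = W (A j')) → 6 * (2 : ℝ) ^ ((1 : ℝ) / 3) * (Real.sqrt 2 * Vol k Q) ^ ((2 : ℝ) / 3) ≤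 Fr k Q A + 1 / Real.sqrt 6 * ∑ j, ∑ j', (if (col j = col j' ∧ col j ≠ 0 ∧ τ j ≠ τ j') then |⟪wS (col j), nv j j'⟫_ℝ| * facetArea (closure (Q j) ∩ closure (Q j')) (nv j j') else 0) := by
  intro Λ Brl Ax Φ Per ι W Vol Fr k H Q A nv τ q col A₀ ax t uS wS δ hbd hdisj hanti hplane hax hδ hcol hcore hsepcol
    hcoreBody hAx hON hBM hτ
  -- the star-shaped tree: node `0` = core, node `i.succ` = colony `i`
  set slid : Fin (q + 1) → Bool := fun F => Fin.cases (motive := fun _ => Bool) false (fun _ => true) F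
    with hslid
  set mS : Fin (q + 1) → EuclideanSpace ℝ (Fin 3) :=
    fun F => Fin.cases (motive := fun _ => EuclideanSpace ℝ (Fin 3)) 0 ax F with hmS
  have hslid0 : slid 0 = false := by simp [hslid]
  have hslidS : ∀ i : Fin q, slid i.succ = true := fun i => by simp [hslid]
  have hmSS : ∀ i : Fin q, mS i.succ = ax i := fun i => by simp [hmS]
  have hslid_iff : ∀ F, slid F = true ↔ F ≠ 0 := by
    intro F
    refine Fin.cases ?_ (fun i => ?_) F
    · rw [hslid0]; simp
    · rw [hslidS]; simp [Fin.succ_ne_zero]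
  have hsucc_of : ∀ F : Fin (q + 1), slid F = true → ∃ i : Fin q, F = i.succ := by
    intro F hF
    rcases Fin.eq_zero_or_eq_succ F with h | h
    · rw [h, hslid0] at hF; exact Bool.noConfusion hF
    · exact h
  have hR := rung_superTree_cells k H A nv τ q (fun _ => 0) ax t col (fun _ => A₀) slid mS uS wS δ hbd hdisj
    hanti hplane (fun i => Nat.zero_le _) hax (fun _ _ => rfl) hcol hδ hcore ?_ ?_ ?_ ?_ ?_ hτ
    (fun i h => by rw [hslid0] at h; exact Bool.noConfusion h)
    (fun i _ => by rw [real_inner_comm]; exact (hON i).2.2.2.1)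
  · -- conclusion: `slid (col j) = true ↔ col j ≠ 0`
    have e : (∑ j, ∑ j', (if (col j = col j' ∧ slid (col j) = true ∧ τ j ≠ τ j') then
        |⟪wS (col j), nv j j'⟫_ℝ| * facetArea (closure (Q j) ∩ closure (Q j')) (nv j j') else 0)) =
        ∑ j, ∑ j', (if (col j = col j' ∧ col j ≠ 0 ∧ τ j ≠ τ j') then
          |⟪wS (col j), nv j j'⟫_ℝ| * facetArea (closure (Q j) ∩ closure (Q j')) (nv j j') else 0) :=
      Finset.sum_congr rfl fun j _ => Finset.sum_congr rfl fun j' _ =>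
        if_congr (by rw [hslid_iff]) rfl rfl
    rw [e] at hR
    exact hR
  · -- non-adjacent distinct nodes are two distinct colonies
    intro j j' hne h1 h2 x hx y hy
    have hj : col j ≠ 0 := by
      intro h0
      rcases Fin.eq_zero_or_eq_succ (col j') with h' | ⟨i, hi⟩
      · exact hne (h0.trans h'.symm)
      · exact h1 i ⟨h0, hi⟩
    have hj' : col j' ≠ 0 := by
      intro h0
      rcases Fin.eq_zero_or_eq_succ (col j) with h' | ⟨i, hi⟩
      · exact hne (h'.trans h0.symm)
      · exact h2 i ⟨h0, hi⟩
    exact hsepcol j j' hne hj hj' x hx y hy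
  · -- single-body node = the core
    intro j hj
    rcases Fin.eq_zero_or_eq_succ (col j) with h | ⟨i, hi⟩
    · exact hcoreBody j h
    · rw [hi, hslidS] at hj; exact Bool.noConfusion hj
  · -- slid nodes = the colonies
    intro j hj
    obtain ⟨i, hi⟩ := hsucc_of (col j) hj
    rw [hi, hmSS]
    exact hAx i j hi
  · intro F hF
    obtain ⟨i, rfl⟩ := hsucc_of F hF
    rw [hmSS]
    exact hON i
  · intro F hF
    obtain ⟨i, rfl⟩ := hsucc_of F hF
    exact hBM i

end Summit.Ventures.Crystal3D.Cruxes.PolycrystalWulffBound.PolyDensity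

end
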